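import Summits.AtomisticToContinuum.HydrodynamicLimit.Theorems.RelayRaceLocalityGibbsLightConeBridge
import Summits.AtomisticToContinuum.HydrodynamicLimit.Theorems.RelayRaceLocalityGibbsLightConeStubChainOfMember
import Summits.AtomisticToContinuum.HydrodynamicLimit.Theorems.RelayRaceLocalityGibbsLightConeStubChainSpanBudget

/-!
# Chain bridge `ChainTail → GibbsLightCone` of the line `Sketch` (log-window-tagged-tail) for the crux
`RelayRaceLocality.GibbsLightCone` (stmt-AtomisticToContinuum-12501)

Support file (`--supports stmt-AtomisticToContinuum-12501`) of the line's lead prover, companion of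
`RelayRaceLocalityGibbsLightConeBridge.lean`. Revision 5 of the registered skeleton
(`Cruxes/GibbsLightCone/Lines/Sketch.lean`) decomposes the kinetic-scale stub into two landed
DETERMINISTIC stubs — `stub_chainOfMember` (a member of the APST backward cluster is joined to the
tagged particle by a strictly time-ordered collision chain) and `stub_chainSpanBudget` (along a chain
the span is at most the baton's path length plus `k` contact offsets) — and ONE open stub
`stub_chainPathLengthTail` (the exponential-in-`M` tail, under the invariant Gibbs law, of the event
that some collision chain ending at the tagged particle over a window of `M ∈ [1, K log(N+2)]`
mean-free-time units has path length plus offsets `> λ M ℓ_N`). This file proves the composition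
`taggedLogWindowSpanTail_of_chainPathLengthTail` (chain tail ⇒ tagged log-window span tail) and the
single-hypothesis bridge `gibbsLightCone_of_chainPathLengthTail` (chain tail ⇒ crux). Nothing is
asserted about the open stub; it enters as a hypothesis written out verbatim.
-/

namespace Summit.AtomisticToContinuum.HydrodynamicLimit.Theorems.LogWindowTaggedTail

open Literature.MathematicalPhysics.KineticTheory Literature.Analysis.FluidPDE MeasureTheory Filter Set

open scoped ENNReal

/-- THE TAGGED LOG-WINDOW SPAN TAIL FROM THE CHAIN TAIL (deterministic composition): a far member
has a collision chain into `p` (`stub_chainOfMember`), whose path length plus contact offsets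
dominates the span (`stub_chainSpanBudget`); the own-displacement clause `r = p` is the chain with
no link; the Gibbs law does not charge the bad set. [folklore] -/
theorem taggedLogWindowSpanTail_of_chainPathLengthTail :
    (∀ (N : ℕ) (ε : ℝ) (Φ : HardSphereFlow (Torus.geometry (Fin 3)) ε N)
      (z : Config N (Fin 3) T3),
      z ∈ Φ.good → ∀ (i j : Fin N) (s t : ℝ), j ∈ Φ.backwardCluster i s t z →
        ∃ (k : ℕ) (q : Fin (k + 1) → Fin N) (τ : Fin k → ℝ),
          q 0 = j ∧ q (Fin.last k) = i ∧ StrictMono τ ∧ (∀ m, τ m ∈ Set.Ioc s t) ∧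
          ∀ m : Fin k, s(q (Fin.castSucc m), q (Fin.succ m)) ∈
            contactPairSet (Torus.geometry (Fin 3)) ε (Φ.flow (τ m) z)) →
    (∀ (N : ℕ) (ε : ℝ) (Φ : HardSphereFlow (Torus.geometry (Fin 3)) ε N)
      (z : Config N (Fin 3) T3),
      z ∈ Φ.good → ∀ (k : ℕ) (q : Fin (k + 1) → Fin N) (T : Fin (k + 2) → ℝ), Monotone T →
        (∀ m : Fin k, s(q (Fin.castSucc m), q (Fin.succ m)) ∈
          contactPairSet (Torus.geometry (Fin 3)) ε (Φ.flow (T (Fin.castSucc (Fin.succ m))) z)) →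
        Torus.euclidDist ((Φ.flow (T 0) z) (q 0)).1
            ((Φ.flow (T (Fin.last (k + 1))) z) (q (Fin.last k))).1 ≤
          (∑ m : Fin (k + 1), ∫ u in T (Fin.castSucc m)..T (Fin.succ m), ‖((Φ.flow u z) (q m)).2‖) +
            k * ε) →
    (∀ a θ : ℝ, 0 < a → 0 < θ → ∃ σ₀ : ℝ, 0 < σ₀ ∧ ∃ lam c C : ℝ, 0 < c ∧ ∀ K : ℝ, 0 < K →
      ∀ σ : ℝ, 0 < σ → σ < σ₀ →
      ∀ Φ : (N : ℕ) → HardSphereFlow (Torus.geometry (Fin 3)) (hsDiameter σ N) (N + 1),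
      ∀ᶠ N in atTop, ∀ p : Fin (N + 1), ∀ M : ℝ, 1 ≤ M → M ≤ K * Real.log ((N : ℝ) + 2) →
        localGibbsLaw σ (fun _ => a) (fun _ => 0) (fun _ => θ) N (Φ N)
          {z | ∃ (k : ℕ) (q : Fin (k + 1) → Fin (N + 1)) (T : Fin (k + 2) → ℝ),
              q (Fin.last k) = p ∧ Monotone T ∧
              StrictMono (fun m : Fin k => T (Fin.castSucc (Fin.succ m))) ∧ T 0 = 0 ∧
              T (Fin.last (k + 1)) = M * (((N + 1 : ℕ) : ℝ) ^ (-(1 / 3 : ℝ)) / σ ^ 2 / Real.sqrt θ) ∧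
              (∀ m : Fin k, s(q (Fin.castSucc m), q (Fin.succ m)) ∈
                contactPairSet (Torus.geometry (Fin 3)) (hsDiameter σ N)
                  ((Φ N).flow (T (Fin.castSucc (Fin.succ m))) z)) ∧
              lam * M * (((N + 1 : ℕ) : ℝ) ^ (-(1 / 3 : ℝ)) / σ ^ 2) <
                (∑ m : Fin (k + 1), ∫ u in T (Fin.castSucc m)..T (Fin.succ m),
                    ‖(((Φ N).flow u z) (q m)).2‖) + k * hsDiameter σ N}
          ≤ ENNReal.ofReal (C * Real.exp (-c * M))) →
    ∀ a θ : ℝ, 0 < a → 0 < θ → ∃ σ₀ : ℝ, 0 < σ₀ ∧ ∃ lam c C : ℝ, 0 < c ∧ ∀ K : ℝ, 0 < K →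
      ∀ σ : ℝ, 0 < σ → σ < σ₀ →
      ∀ Φ : (N : ℕ) → HardSphereFlow (Torus.geometry (Fin 3)) (hsDiameter σ N) (N + 1),
      ∀ᶠ N in atTop, ∀ p : Fin (N + 1), ∀ M : ℝ, 1 ≤ M → M ≤ K * Real.log ((N : ℝ) + 2) →
        localGibbsLaw σ (fun _ => a) (fun _ => 0) (fun _ => θ) N (Φ N)
          {z | ∃ r : Fin (N + 1),
              (r = p ∨ r ∈ (Φ N).backwardCluster p 0
                (M * (((N + 1 : ℕ) : ℝ) ^ (-(1 / 3 : ℝ)) / σ ^ 2 / Real.sqrt θ)) z) ∧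
              lam * M * (((N + 1 : ℕ) : ℝ) ^ (-(1 / 3 : ℝ)) / σ ^ 2) <
                Torus.euclidDist (z r).1
                  (((Φ N).flow (M * (((N + 1 : ℕ) : ℝ) ^ (-(1 / 3 : ℝ)) / σ ^ 2 / Real.sqrt θ)) z)
                    p).1}
          ≤ ENNReal.ofReal (C * Real.exp (-c * M)) := by
  intro hChain hSpan hTail a θ ha hθ
  obtain ⟨σ₀, hσ₀, lam, c, C, hc, H⟩ := hTail a θ ha hθ
  refine ⟨σ₀, hσ₀, lam, c, C, hc, fun K hK σ hσ hσσ₀ Φ => ?_⟩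
  filter_upwards [H K hK σ hσ hσσ₀ Φ] with N hN p M hM hMK
  refine le_trans ?_ (hN p M hM hMK)
  -- abbreviations
  set W : ℝ := M * (((N + 1 : ℕ) : ℝ) ^ (-(1 / 3 : ℝ)) / σ ^ 2 / Real.sqrt θ) with hW
  set L : ℝ := lam * M * (((N + 1 : ℕ) : ℝ) ^ (-(1 / 3 : ℝ)) / σ ^ 2) with hL
  set P := localGibbsLaw σ (fun _ => a) (fun _ => 0) (fun _ => θ) N (Φ N) with hP
  have hW0 : 0 ≤ W := by
    have : 0 < ((N + 1 : ℕ) : ℝ) ^ (-(1 / 3 : ℝ)) / σ ^ 2 / Real.sqrt θ := by positivity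
    exact mul_nonneg (by linarith) this.le
  have hnull : P (Φ N).goodᶜ = 0 := by
    rw [hP, localGibbsLaw, particleLaw_eq]
    exact withDensity_absolutelyContinuous _ _ (Φ N).measure_compl_good
  rw [← measure_inter_conull hnull]
  refine measure_mono ?_
  rintro z ⟨⟨r, hr, hdist⟩, hz⟩
  have hz' : z ∈ (Φ N).good := hz
  rcases hr with rfl | hmem
  · -- own displacement: the chain with no link
    have hmono2 : Monotone (![0, W] : Fin 2 → ℝ) := by
      refine Fin.monotone_iff_le_succ.2 fun i => ?_
      fin_cases i
      simpa using hW0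
    refine ⟨0, fun _ => r, ![0, W], rfl, hmono2, fun m => m.elim0, rfl, rfl, fun m => m.elim0, ?_⟩
    · have hspan := hSpan (N + 1) (hsDiameter σ N) (Φ N) z hz' 0 (fun _ => r) ![0, W] hmono2
        (fun m => m.elim0)
      have h0 : (Φ N).flow ((![0, W] : Fin 2 → ℝ) 0) z = z := by
        simpa using (Φ N).flow_zero z hz'
      have h1 : (![0, W] : Fin 2 → ℝ) (Fin.last 1) = W := rfl
      rw [h0, h1] at hspan
      simp only [Nat.cast_zero, zero_mul, add_zero] at hspan ⊢
      exact lt_of_lt_of_le hdist hspan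
  · -- a genuine member: its collision chain into `p`
    obtain ⟨k, q, τ, hq0, hqk, hmono, hwin, hlink⟩ :=
      hChain (N + 1) (hsDiameter σ N) (Φ N) z hz' p r 0 W hmem
    -- extended hand-over times: window start, the link times, window end
    let T : Fin (k + 2) → ℝ := fun i =>
      if (i : ℕ) = 0 then 0 else if h : (i : ℕ) - 1 < k then τ ⟨(i : ℕ) - 1, h⟩ else W
    have hT0 : T 0 = 0 := by simp [T]
    have hTlast : T (Fin.last (k + 1)) = W := by
      simp [T]
    have hTlink : ∀ m : Fin k, T (Fin.castSucc (Fin.succ m)) = τ m := by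
      intro m
      simp [T]
    have hTval : ∀ i : Fin (k + 2), T i = if (i : ℕ) = 0 then 0
        else if h : (i : ℕ) - 1 < k then τ ⟨(i : ℕ) - 1, h⟩ else W := fun i => rfl
    have hTle : ∀ i : Fin (k + 2), 0 ≤ T i ∧ T i ≤ W := by
      intro i
      rw [hTval]
      split_ifs with h0 h1
      · exact ⟨le_rfl, hW0⟩
      · exact ⟨(hwin _).1.le, (hwin _).2⟩
      · exact ⟨hW0, le_rfl⟩
    have hTmono : Monotone T := by
      intro i j hij
      rw [hTval i, hTval j]
      have hij' : (i : ℕ) ≤ (j : ℕ) := hij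
      by_cases hi0 : (i : ℕ) = 0
      · rw [if_pos hi0]
        split_ifs with h0 h1
        · exact le_rfl
        · exact (hwin _).1.le
        · exact hW0
      · have hj0 : (j : ℕ) ≠ 0 := by omega
        rw [if_neg hi0, if_neg hj0]
        by_cases hjk : (j : ℕ) - 1 < k
        · have hik : (i : ℕ) - 1 < k := by omega
          rw [dif_pos hik, dif_pos hjk]
          exact hmono.monotone (by
            show (⟨(i : ℕ) - 1, hik⟩ : Fin k) ≤ ⟨(j : ℕ) - 1, hjk⟩
            exact Fin.mk_le_mk.2 (by omega))
        · rw [dif_neg hjk]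
          split_ifs with hik
          · exact (hwin _).2
          · exact le_rfl
    have hlink' : ∀ m : Fin k, s(q (Fin.castSucc m), q (Fin.succ m)) ∈
        contactPairSet (Torus.geometry (Fin 3)) (hsDiameter σ N)
          ((Φ N).flow (T (Fin.castSucc (Fin.succ m))) z) := by
      intro m
      rw [hTlink m]
      exact hlink m
    have hspan := hSpan (N + 1) (hsDiameter σ N) (Φ N) z hz' k q T hTmono hlink'
    rw [hT0, hTlast, hq0, hqk, (Φ N).flow_zero z hz'] at hspan
    have hTstrict : StrictMono (fun m : Fin k => T (Fin.castSucc (Fin.succ m))) := by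
      intro m₁ m₂ h
      simp only [hTlink]
      exact hmono h
    exact ⟨k, q, T, hqk, hTmono, hTstrict, hT0, hTlast, hlink', lt_of_lt_of_le hdist hspan⟩

/-- BRIDGE (chain form): the chain path-length tail — under the invariant Gibbs law, the
probability that SOME collision chain (baton path) ending at the tagged particle at the end of a
window of `M ∈ [1, K log(N+2)]` mean-free-time units has path length plus contact offsets
`> λ M ℓ_N` is `≤ C e^{-cM}` (eventually in `N`) — implies the crux `RelayRaceLocality.GibbsLightCone`
(chain of member + chain span budget + the log-window reduction, all landed). [folklore] -/
theorem gibbsLightCone_of_chainPathLengthTail :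
    (∀ a θ : ℝ, 0 < a → 0 < θ → ∃ σ₀ : ℝ, 0 < σ₀ ∧ ∃ lam c C : ℝ, 0 < c ∧ ∀ K : ℝ, 0 < K →
      ∀ σ : ℝ, 0 < σ → σ < σ₀ →
      ∀ Φ : (N : ℕ) → HardSphereFlow (Torus.geometry (Fin 3)) (hsDiameter σ N) (N + 1),
      ∀ᶠ N in atTop, ∀ p : Fin (N + 1), ∀ M : ℝ, 1 ≤ M → M ≤ K * Real.log ((N : ℝ) + 2) →
        localGibbsLaw σ (fun _ => a) (fun _ => 0) (fun _ => θ) N (Φ N)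
          {z | ∃ (k : ℕ) (q : Fin (k + 1) → Fin (N + 1)) (T : Fin (k + 2) → ℝ),
              q (Fin.last k) = p ∧ Monotone T ∧
              StrictMono (fun m : Fin k => T (Fin.castSucc (Fin.succ m))) ∧ T 0 = 0 ∧
              T (Fin.last (k + 1)) = M * (((N + 1 : ℕ) : ℝ) ^ (-(1 / 3 : ℝ)) / σ ^ 2 / Real.sqrt θ) ∧
              (∀ m : Fin k, s(q (Fin.castSucc m), q (Fin.succ m)) ∈
                contactPairSet (Torus.geometry (Fin 3)) (hsDiameter σ N)
                  ((Φ N).flow (T (Fin.castSucc (Fin.succ m))) z)) ∧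
              lam * M * (((N + 1 : ℕ) : ℝ) ^ (-(1 / 3 : ℝ)) / σ ^ 2) <
                (∑ m : Fin (k + 1), ∫ u in T (Fin.castSucc m)..T (Fin.succ m),
                    ‖(((Φ N).flow u z) (q m)).2‖) + k * hsDiameter σ N}
          ≤ ENNReal.ofReal (C * Real.exp (-c * M))) →
    Summit.AtomisticToContinuum.HydrodynamicLimit.Theses.RelayRaceLocality.GibbsLightCone :=
  fun hTail => gibbsLightCone_of_taggedLogWindowSpanTail
    (taggedLogWindowSpanTail_of_chainPathLengthTail stub_chainOfMember stub_chainSpanBudget hTail)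

end Summit.AtomisticToContinuum.HydrodynamicLimit.Theorems.LogWindowTaggedTail
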